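import Mathlib.Algebra.MonoidAlgebra.Basic
import Mathlib.Algebra.MonoidAlgebra.MapDomain
import Mathlib.Algebra.MvPolynomial.Degrees
import Mathlib.Algebra.Algebra.Basic
import Mathlib.LinearAlgebra.Finsupp.LinearCombination
import Mathlib.LinearAlgebra.Basis.Defs
import Mathlib.Algebra.BigOperators.Fin
import Mathlib.Data.Fin.Tuple.Basic
import Mathlib.Data.Nat.Log
import Mathlib.FieldTheory.IsAlgClosed.Basic
import HarnessLib

/-!
# Barrier catalogue `ValiantsHypothesis`: every polynomial is easy over a noncommutative
extension ring (Hrubeš–Yehudayoff 2011) — extension-robust lower bounds stop at `O(dn)`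

D-0021 barrier entry for the summit `ValiantsHypothesis` (`VP ≠ VNP`). The obstruction bears on
FORMULA (a fortiori circuit) lower bounds for explicit polynomials such as the permanent
(`VNP ⊄ VF`, `VNP ⊄ VP`, consequences of `ValiantsHypothesis`): any lower-bound argument that
remains valid when the coefficient field `F` is replaced by an arbitrary ring `R' ⊇ F` having `F`
in its centre (ring operations at unit cost) cannot show more than `L(f) = O(dn)` for a
polynomial of degree `d` in `n` variables, because over a suitable such `R'` every `f` HAS a
formula of that size.

**The printed results** (Theory of Computing 7 (2011) 119–129, checked with `lit read`).

* Model (§2): "An arithmetic circuit `Φ` over the ring `R` and the variables `X` is a directed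
  acyclic graph with every node of indegree either two or zero ... every vertex of indegree 0 is
  labelled either by a variable in `X` or by an element of `R`. Every other node ... is labelled
  either by `×` or by `+`. ... a formula if the outdegree of each node is one ... The size of a
  circuit is the number of nodes"; "`L_R(f)` the size of a smallest formula over `R` computing
  `f`"; "`R[X]` the ring of polynomials ... Note that the variables multiplicatively commute with
  each other, as well as with every element of `R`, whether the ring `R` is commutative or
  not." §1: "We always assume that the field `F` is in the center of the extension ring `R`".
* Thm. 3.2: "Let `R` be a ring. Let `f ∈ R[X]` be a polynomial of degree `d` (recall `|X| = n`).
  Then there exists `R' ⊇ R` such that `L_{R'}(f) = O(dn)`." Followed by: "The ring `R'`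
  depends on the polynomial `f`. Moreover, it is a noncommutative ring of a large finite
  dimension. (The dimension can be taken roughly as `n^d`.) As we will see, noncommutativity
  and a significant increase in dimension are inevitable." (Proof: the formula
  `∏_{i ≤ d} ∑_j z_{ij} x_j` over the free algebra `S = R⟨z_{ij}⟩` modulo the ideal generated by
  the `F_J - f_J`, shown to meet `R` trivially.)
* Cor. 3.3: "Let `R` be a ring. Then there exists a ring `R' ⊇ R` such that for every
  `f ∈ R[X]` of degree `d`, `L_{R'}(f) = O(dn)`. The ring `R'` depends neither on `f` nor on
  `d`, and it has infinite dimension over `R`."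
* Thm. 3.4: "Assume that `F` is an algebraically closed field. Let `R` be a subring of `F` and
  let `R' ⊇ R` be a commutative ring. Then for every `f ∈ R[X]`, we have `C_F(f) ≤ C_{R'}(f)`
  and `L_F(f) ≤ L_{R'}(f)`." (Nullstellensatz.) Thm. 3.7 / Cor. 3.8: over every field there
  are zero-one polynomials with large `C_F`, `L_F` — "a theorem without which proving lower
  bounds for algebraic circuits would be virtually impossible" (§1).
* §2 (dimension): "`dim_R(R')` ... the smallest natural number `k` such that there exist
  `e_1, …, e_k ∈ R'` with ... `e_1 = 1` and every `a ∈ R` commutes with every `e_i` ... every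
  `b ∈ R'` can be uniquely written as `∑ b_i e_i`, with `b_i ∈ R`." Thm. 4.2: "Let `R` and
  `R' ⊇ R` be rings such that `dim_R(R') = k`. Let `f ∈ R[X]`. Then `C_R(f) ≤ O(k³) C_{R'}(f)`
  and `L_R(f) ≤ (L_{R'}(f))^{O(log k)}`."
* §1: "In principle, the circuit complexity of a polynomial can decrease when working in a
  larger field or ring. This is related to the fact that in the circuit model, we assume that
  addition and multiplication of elements of the underlying ring can be performed at unit cost,
  no matter how complicated the ring is." "any polynomial of degree `d` in `n` variables has a
  formula of size `O(dn)` over some noncommutative ring extension" ("a mildly surprising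
  observation (that generalizes the Clifford-based formulas for the permanent)").

**Rendering.** `NCFormula A σ` is exactly the printed formula model over a (not necessarily
commutative) semiring `A`: binary trees with leaves `var i` / `const c`, internal nodes `+`, `×`,
`size` = number of nodes; its semantics `NCFormula.eval` lives in the polynomial ring `A[X]` with
CENTRAL variables, i.e. Mathlib's `AddMonoidAlgebra A (σ →₀ ℕ)` (which is `MvPolynomial σ A`
verbatim when `A` is commutative); `ncFormulaSize g = L_A(g)`; `baseChange R' f` is
`f ∈ R[X] ⊆ R'[X]` along `algebraMap R R'` (an `R`-algebra `R'` with injective `algebraMap` is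
precisely a ring extension with `R` central). Design choice: the tree's commutative formula model
`Literature.Computability.AlgebraicComplexity.ArithCircuit.IsFormula` / `Literature.Computability.AlgebraicComplexity.formulaComplexity` (`CircuitDepth.lean`) is NOT
reused, because its semantics is `MvPolynomial σ k` over a COMMUTATIVE semiring `k`, while the
whole point here is a noncommutative coefficient ring `R'`, and both sides of Thm. 3.4 / Thm. 4.2
must live in one model; `NCFormula` counts leaves (HY's node count), `formulaComplexity` counts
gates only.

**What this file does.** Thm. 3.2 / Cor. 3.3 are PROVED for every commutative base ring `R`
(the case of the barrier, `R = F` a field), with the explicit ring `HYRing R` — the `R`-linear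
endomorphisms of the free `R`-module on stacks of frames (`Stack = List (List ℕ)`), which
depends only on `R` — and the explicit bound `L_{R'}(f) ≤ 6·d·n + 1` for `f` of total degree
`≤ d` in `n` variables (`ncFormulaSize_baseChange_le`). The tree's proof is not HY's free-algebra
quotient but an operator model of the same relations: letters `Z_{j,e}` (`zOp`) act on basis
stacks by opening a run, recording exponents, and closing the run with the scalar
`coeff_{(e_0,…,e_{n-1})}(f)`, so that the ordered product over the variables of the Horner blocks
`∑_{e ≤ d} Z_{j,e} x_j^e` (size `4d+1` each) evaluates to `f` (`eval_hyFormula_eq`). The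
technique class `ExtensionRobustLowerBound R f s` and the barrier `NoncommutativeExtensions`
(no extension-robust bound exceeds `6dn+1`; proved here in its pointed form
`not_extensionRobustLowerBound`) follow; Thm. 3.4 and the formula half of Thm. 4.2 are vendored
as named facts (not proved here). The canonical discharges `theorem <Fact>_holds : <Fact>`
(CONVENTIONS §4) of `HrubesYehudayoff2011_thm32`, `HrubesYehudayoff2011_cor33`,
`NoncommutativeExtensions` — two-line packagings of `ncFormulaSize_baseChange_le` /
`not_extensionRobustLowerBound` — and the proof of `HrubesYehudayoff2011_thm34_formulas` live in
the companion file `NoncommutativeExtensionsProofs.lean` (one statement, one theorem: this file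
keeps no second copy of those discharges).

## References

* [HrubesYehudayoff2011] P. Hrubeš, A. Yehudayoff, *Arithmetic complexity in ring extensions*,
  Theory of Computing 7 (2011) 119–129, §1, §2, Prop. 3.1, Thm. 3.2, Cor. 3.3, Thm. 3.4,
  Thm. 3.7, Cor. 3.8, Lemma 4.1, Thm. 4.2.
-/

noncomputable section

namespace Literature.Barriers.ValiantsHypothesis

open AddMonoidAlgebra

universe u v

/-! ### The printed formula model over a (noncommutative) ring -/

/-- **Formulas over a ring `A` (possibly noncommutative)**: trees with leaves labelled by a
variable or a ring element and internal nodes `+`, `×` of indegree two.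
[cite: HrubesYehudayoff2011, §2 (Arithmetic circuits and formulas)] -/
inductive NCFormula (A : Type u) (σ : Type v) : Type (max u v)
  /-- the input variable `x_i` -/
  | var (i : σ) : NCFormula A σ
  /-- the ring constant `c ∈ A` -/
  | const (c : A) : NCFormula A σ
  /-- a sum gate -/
  | add (φ ψ : NCFormula A σ) : NCFormula A σ
  /-- a product gate (ordered: `φ × ψ`) -/
  | mul (φ ψ : NCFormula A σ) : NCFormula A σ

namespace NCFormula

variable {A : Type u} {σ : Type v}

/-- The size of a formula: its number of nodes (leaves included).
[cite: HrubesYehudayoff2011, §2 ("The size of a circuit is the number of nodes")] -/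
def size : NCFormula A σ → ℕ
  | var _ => 1
  | const _ => 1
  | add φ ψ => φ.size + ψ.size + 1
  | mul φ ψ => φ.size + ψ.size + 1

/-- Unfolding of `size`. [folklore] -/
@[simp] theorem size_var (i : σ) : (var i : NCFormula A σ).size = 1 := rfl
/-- Unfolding of `size`. [folklore] -/
@[simp] theorem size_const (c : A) : (const c : NCFormula A σ).size = 1 := rfl
/-- Unfolding of `size`. [folklore] -/
@[simp] theorem size_add (φ ψ : NCFormula A σ) : (add φ ψ).size = φ.size + ψ.size + 1 := rfl
/-- Unfolding of `size`. [folklore] -/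
@[simp] theorem size_mul (φ ψ : NCFormula A σ) : (mul φ ψ).size = φ.size + ψ.size + 1 := rfl

/-- Every formula has at least one node. [folklore] -/
theorem one_le_size (φ : NCFormula A σ) : 1 ≤ φ.size := by
  cases φ <;> simp

/-- Horner block in the variable `x_i` with coefficients `c 0, …, c d`:
`c 0 + x_i (c 1 + x_i (⋯ (c (d-1) + x_i · c d)))`. [folklore] -/
def horner (i : σ) : (d : ℕ) → (Fin (d + 1) → A) → NCFormula A σ
  | 0, c => const (c 0)
  | d + 1, c => add (const (c 0)) (mul (var i) (horner i d (Fin.tail c)))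

/-- A Horner block of degree `d` has `4d + 1` nodes. [folklore] -/
@[simp] theorem size_horner (i : σ) (d : ℕ) (c : Fin (d + 1) → A) :
    (horner i d c).size = 4 * d + 1 := by
  induction d with
  | zero => rfl
  | succ d ih => simp [horner, ih]; ring

/-- The ordered product of a list of formulas (`[]` ↦ the constant `1`). [folklore] -/
def prodList [One A] : List (NCFormula A σ) → NCFormula A σ
  | [] => const 1
  | [φ] => φ
  | φ :: ψ :: rest => mul φ (prodList (ψ :: rest))

/-- Size of an ordered product of `ℓ ≥ 1` formulas: the sizes plus `ℓ - 1` product nodes. [folklore] -/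
theorem size_prodList_cons [One A] (φ : NCFormula A σ) (l : List (NCFormula A σ)) :
    (prodList (φ :: l)).size + 1 = ((φ :: l).map size).sum + (φ :: l).length := by
  induction l generalizing φ with
  | nil => simp [prodList]
  | cons ψ rest ih =>
    rw [prodList, size_mul]
    have := ih ψ
    simp only [List.map_cons, List.sum_cons, List.length_cons] at this ⊢
    omega

variable [Semiring A]

/-- **Semantics** in the polynomial ring `A[X]` with central variables (`x_i x_j = x_j x_i`,
`x_i a = a x_i`): Mathlib's `AddMonoidAlgebra A (σ →₀ ℕ)`.
[cite: HrubesYehudayoff2011, §2 (Rings and polynomials)] -/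
def eval : NCFormula A σ → AddMonoidAlgebra A (σ →₀ ℕ)
  | var i => single (Finsupp.single i 1) 1
  | const c => single 0 c
  | add φ ψ => φ.eval + ψ.eval
  | mul φ ψ => φ.eval * ψ.eval

/-- Unfolding of `eval`. [folklore] -/
@[simp] theorem eval_var (i : σ) : (var i : NCFormula A σ).eval = single (Finsupp.single i 1) 1 :=
  rfl
/-- Unfolding of `eval`. [folklore] -/
@[simp] theorem eval_const (c : A) : (const c : NCFormula A σ).eval = single 0 c := rfl
/-- Unfolding of `eval`. [folklore] -/
@[simp] theorem eval_add (φ ψ : NCFormula A σ) : (add φ ψ).eval = φ.eval + ψ.eval := rfl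
/-- Unfolding of `eval`. [folklore] -/
@[simp] theorem eval_mul (φ ψ : NCFormula A σ) : (mul φ ψ).eval = φ.eval * ψ.eval := rfl

/-- The Horner block computes `∑_{e ≤ d} c_e x_i^e` (with the noncommuting coefficients on the
left; `x_i` is central). [folklore] -/
theorem eval_horner (i : σ) (d : ℕ) (c : Fin (d + 1) → A) :
    (horner i d c).eval = ∑ e : Fin (d + 1), single ((e : ℕ) • Finsupp.single i 1) (c e) := by
  induction d with
  | zero => simp [horner]
  | succ d ih =>
    conv_rhs => rw [Fin.sum_univ_succ]
    rw [horner, eval_add, eval_const, eval_mul, eval_var, ih, Finset.mul_sum]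
    congr 1
    · simp
    · refine Finset.sum_congr rfl fun e _ => ?_
      rw [single_mul_single, one_mul, Fin.tail, Fin.val_succ, succ_nsmul']

/-- `prodList` computes the ordered product. [folklore] -/
theorem eval_prodList (l : List (NCFormula A σ)) : (prodList l).eval = (l.map eval).prod := by
  induction l with
  | nil => simp [prodList, one_def]
  | cons φ rest ih =>
    cases rest with
    | nil => simp [prodList]
    | cons ψ rest' => rw [prodList, eval_mul, ih]; simp

/-- Powers of a variable as a formula (`x_i^0 ↦ 1`). [folklore] -/
def varPow (i : σ) : ℕ → NCFormula A σ
  | 0 => const 1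
  | e + 1 => mul (var i) (varPow i e)

/-- `varPow i e` computes `x_i^e`. [folklore] -/
theorem eval_varPow (i : σ) (e : ℕ) : (varPow i e : NCFormula A σ).eval = single (Finsupp.single i e) 1 := by
  induction e with
  | zero => simp [varPow]
  | succ e ih =>
    rw [varPow, eval_mul, eval_var, ih, single_mul_single, one_mul, ← Finsupp.single_add, add_comm]

/-- Every monomial is computed by some formula. [folklore] -/
theorem exists_eval_eq_single (m : σ →₀ ℕ) (c : A) :
    ∃ φ : NCFormula A σ, φ.eval = single m c := by
  induction m using Finsupp.induction with
  | zero => exact ⟨const c, rfl⟩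
  | single_add i e m _ _ ih =>
    obtain ⟨φ, hφ⟩ := ih
    refine ⟨mul (varPow i e) φ, ?_⟩
    rw [eval_mul, eval_varPow, hφ, single_mul_single, one_mul]

/-- Every element of `A[X]` is computed by some formula (so `ncFormulaSize` below is never the
junk value `sInf ∅`). [folklore] -/
theorem exists_eval_eq (g : AddMonoidAlgebra A (σ →₀ ℕ)) : ∃ φ : NCFormula A σ, φ.eval = g := by
  induction g using AddMonoidAlgebra.induction_linear with
  | zero => exact ⟨const 0, by simp⟩
  | add x y hx hy =>
    obtain ⟨φ, hφ⟩ := hx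
    obtain ⟨ψ, hψ⟩ := hy
    exact ⟨add φ ψ, by rw [eval_add, hφ, hψ]⟩
  | single m c => exact exists_eval_eq_single m c

end NCFormula

/-- **`L_A(g)`**: the least size of a formula over `A` computing `g ∈ A[X]`.
[cite: HrubesYehudayoff2011, §2 ("`L_R(f)` the size of a smallest formula over `R` computing `f`")] -/
def ncFormulaSize {A : Type u} [Semiring A] {σ : Type v} (g : AddMonoidAlgebra A (σ →₀ ℕ)) : ℕ :=
  sInf {s | ∃ φ : NCFormula A σ, φ.eval = g ∧ φ.size = s}

/-- Any formula computing `g` bounds `L_A(g)`. [folklore] -/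
theorem ncFormulaSize_le_size {A : Type u} [Semiring A] {σ : Type v}
    {g : AddMonoidAlgebra A (σ →₀ ℕ)} (φ : NCFormula A σ) (h : φ.eval = g) :
    ncFormulaSize g ≤ φ.size :=
  Nat.sInf_le ⟨φ, h, rfl⟩

/-- `L_A(g) ≥ 1`: the infimum is attained by a formula, which has a node. [folklore] -/
theorem one_le_ncFormulaSize {A : Type u} [Semiring A] {σ : Type v}
    (g : AddMonoidAlgebra A (σ →₀ ℕ)) : 1 ≤ ncFormulaSize g := by
  obtain ⟨φ₀, h₀⟩ := NCFormula.exists_eval_eq g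
  have hne : {s | ∃ φ : NCFormula A σ, φ.eval = g ∧ φ.size = s}.Nonempty := ⟨φ₀.size, φ₀, h₀, rfl⟩
  obtain ⟨φ, -, hs⟩ := Nat.sInf_mem hne
  rw [ncFormulaSize, ← hs]
  exact φ.one_le_size

/-- **`f ∈ R[X]` viewed in `R'[X]`** for an `R`-algebra `R'` (coefficients along
`algebraMap R R'`; when `algebraMap` is injective this is the printed `f ∈ R[X]`, `R ⊆ R'` with
`R` central). [cite: HrubesYehudayoff2011, §2 and Prop. 3.1] -/
def baseChange {R : Type u} [CommSemiring R] (R' : Type*) [Semiring R'] [Algebra R R']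
    {σ : Type v} (f : MvPolynomial σ R) : AddMonoidAlgebra R' (σ →₀ ℕ) :=
  AddMonoidAlgebra.mapRingHom (σ →₀ ℕ) (algebraMap R R') f

/-- Coefficients of the base change. [folklore] -/
@[simp]
theorem coeff_baseChange {R : Type u} [CommSemiring R] (R' : Type*) [Semiring R'] [Algebra R R']
    {σ : Type v} (f : MvPolynomial σ R) (m : σ →₀ ℕ) :
    (baseChange R' f).coeff m = algebraMap R R' (MvPolynomial.coeff m f) :=
  AddMonoidAlgebra.coeff_mapRingHom _ _ _

/-! ### Expansion of an ordered product of operator-valued univariate polynomials -/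

section Expansion

variable {A : Type u} [Semiring A] {G : Type v} [AddCommMonoid G]

/-- `∏_{j<k} (∑_{e ≤ d} a_{j,e} X^{e g_j}) = ∑_{w} (∏_j a_{j,w_j}) X^{∑_j w_j g_j}`, products ordered
by `j` (noncommuting coefficients, central monomials). [folklore] -/
theorem prod_ofFn_sum_single (k d : ℕ) (g : Fin k → G) (a : Fin k → Fin (d + 1) → A) :
    (List.ofFn fun j : Fin k => ∑ e : Fin (d + 1), single ((e : ℕ) • g j) (a j e)).prod =
      ∑ w : Fin k → Fin (d + 1),
        single (∑ j, (w j : ℕ) • g j) ((List.ofFn fun j => a j (w j)).prod) := by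
  induction k with
  | zero =>
    simp [one_def]
  | succ k ih =>
    rw [List.ofFn_succ, List.prod_cons, ih (fun j => g j.succ) (fun j => a j.succ),
      Finset.sum_mul_sum, ← Fintype.sum_prod_type']
    refine Fintype.sum_equiv (Fin.consEquiv fun _ => Fin (d + 1)) _ _ fun p => ?_
    simp only [Fin.consEquiv, Equiv.coe_fn_mk, Fin.sum_univ_succ, Fin.cons_zero, Fin.cons_succ,
      List.ofFn_succ, List.prod_cons, single_mul_single]

end Expansion

/-! ### The extension ring: operators on the free module on stacks of frames -/

section Machine

variable (R : Type u) [CommRing R]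

/-- Stacks of frames; a frame is the list of exponents read so far in the current run (most
recent first). [folklore] -/
abbrev Stack : Type := List (List ℕ)

/-- **The extension ring `R'`** (one ring for all `f`, `n`, `d`, as in Cor. 3.3): the `R`-linear
endomorphisms of the free `R`-module on stacks; an `R`-algebra, so `R` is central.
[cite: HrubesYehudayoff2011, Cor. 3.3] -/
abbrev HYRing : Type u := Module.End R (Stack →₀ R)

/-- `R` acts on `HYRing R` by scalars. [folklore] -/
theorem algebraMap_hyRing_apply (a : R) (x : Stack →₀ R) : algebraMap R (HYRing R) a x = a • x :=
  rfl

/-- `R ⊆ HYRing R`: the structure map is injective (a ring extension). [cite: HrubesYehudayoff2011, Cor. 3.3] -/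
theorem algebraMap_hyRing_injective : Function.Injective (algebraMap R (HYRing R)) := by
  intro a b h
  have := congrArg (fun φ : HYRing R => φ (Finsupp.single [] 1) []) h
  simpa [Module.algebraMap_end_apply] using this

variable {R}
variable (n : ℕ) (wt : List ℕ → R)

/-- One letter `Z_{j,e}` on a basis stack: open a run (`j = n-1`; closing it at once if
`n = 1`), or continue the run on top of the stack (frame of length `n-1-j`), closing it with the
weight of the completed word when `j = 0`; all other stacks are annihilated (the tree's operator
model of the relations `F_J = f_J`). [cite: HrubesYehudayoff2011, Thm. 3.2 (proof)] -/
def zStep (j e : ℕ) (s : Stack) : Stack →₀ R :=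
  if j + 1 = n then
    (if j = 0 then wt [e] • Finsupp.single s 1 else Finsupp.single ([e] :: s) 1)
  else
    match s with
    | [] => 0
    | K :: s' =>
      if K.length + j + 1 = n then
        (if j = 0 then wt (e :: K) • Finsupp.single s' 1 else Finsupp.single ((e :: K) :: s') 1)
      else 0

/-- The operator `Z_{j,e} ∈ HYRing R` (the image of HY's letter `z_{ij}`). [cite: HrubesYehudayoff2011, Thm. 3.2 (proof)] -/
def zOp (j e : ℕ) : HYRing R :=
  Finsupp.linearCombination R (zStep n wt j e)

/-- `Z_{j,e}` on a basis vector. [folklore] -/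
theorem zOp_single (j e : ℕ) (s : Stack) (r : R) :
    zOp n wt j e (Finsupp.single s r) = r • zStep n wt j e s := by
  simp [zOp, Finsupp.linearCombination_single]

/-- The ordered product `Z_{a,e_a} Z_{a+1,e_{a+1}} ⋯` of the letters of a word read from position
`a` (a final segment of a monomial `F_J`'s term). [cite: HrubesYehudayoff2011, Thm. 3.2 (proof)] -/
def prodFrom : ℕ → List ℕ → HYRing R
  | _, [] => 1
  | a, e :: L => zOp n wt a e * prodFrom (a + 1) L

/-- A proper final segment of a run pushes its word as a frame. [folklore] -/
theorem prodFrom_single_of_pos {L : List ℕ} (hL : L ≠ []) {a : ℕ} (ha : a ≠ 0)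
    (h : a + L.length = n) (s : Stack) (r : R) :
    prodFrom n wt a L (Finsupp.single s r) = Finsupp.single (L :: s) r := by
  induction L generalizing a with
  | nil => exact absurd rfl hL
  | cons e L ih =>
    cases L with
    | nil =>
      simp only [List.length_singleton] at h
      simp only [prodFrom, mul_one, zOp_single, zStep, h, if_true, ha, if_false]
      rw [Finsupp.smul_single, smul_eq_mul, mul_one]
    | cons e' L' =>
      have h' : (a + 1) + (e' :: L').length = n := by simp at h ⊢; omega
      rw [prodFrom, Module.End.mul_apply, ih (by simp) (by omega) h', zOp_single, zStep]
      have h1 : ¬ (a + 1 = n) := by simp at h; omega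
      have h2 : (e' :: L').length + a + 1 = n := by simp at h ⊢; omega
      simp only [h1, if_false, h2, if_true, ha]
      rw [Finsupp.smul_single, smul_eq_mul, mul_one]

/-- A complete run acts as the scalar weight of its word, on every basis stack. [folklore] -/
theorem prodFrom_zero_single {L : List ℕ} (hL : L ≠ []) (h : L.length = n) (s : Stack) (r : R) :
    prodFrom n wt 0 L (Finsupp.single s r) = wt L • Finsupp.single s r := by
  cases L with
  | nil => exact absurd rfl hL
  | cons e L =>
    cases L with
    | nil =>
      simp only [List.length_singleton] at h
      simp only [prodFrom, mul_one, zOp_single, zStep, zero_add, h, if_true]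
      rw [smul_comm, Finsupp.smul_single r, smul_eq_mul, mul_one]
    | cons e' L' =>
      have h' : (0 + 1) + (e' :: L').length = n := by simp at h ⊢; omega
      rw [prodFrom, Module.End.mul_apply,
        prodFrom_single_of_pos n wt (by simp) (by omega) h', zOp_single, zStep]
      have h1 : ¬ (0 + 1 = n) := by simp at h; omega
      have h2 : (e' :: L').length + 0 + 1 = n := by simp at h ⊢; omega
      simp only [h1, if_false, h2, if_true]
      rw [smul_comm, Finsupp.smul_single r, smul_eq_mul, mul_one]

/-- `prodFrom` of a tabulated word is the ordered product of its letters. [folklore] -/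
theorem prodFrom_ofFn (k a : ℕ) (w : Fin k → ℕ) :
    prodFrom n wt a (List.ofFn w) = (List.ofFn fun j : Fin k => zOp n wt (a + j) (w j)).prod := by
  induction k generalizing a with
  | zero => simp [prodFrom]
  | succ k ih =>
    rw [List.ofFn_succ, prodFrom, List.ofFn_succ, List.prod_cons, ih]
    simp only [Fin.val_zero, add_zero, Fin.val_succ]
    congr 2
    refine List.ofFn_inj.mpr (funext fun j => ?_)
    rw [show a + 1 + (j : ℕ) = a + ((j : ℕ) + 1) by omega]

/-- **Key identity** (the tree's form of "`F_J = f_J` in `R' = S/I`", Thm. 3.2, proof): for a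
word `w` of length `n ≥ 1` the ordered product `Z_{0,w_0} ⋯ Z_{n-1,w_{n-1}}` is the SCALAR
`wt(w) ∈ R ⊆ HYRing R`. [cite: HrubesYehudayoff2011, Thm. 3.2 (proof)] -/
theorem prod_zOp_eq_algebraMap (hn : n ≠ 0) (w : Fin n → ℕ) :
    (List.ofFn fun j : Fin n => zOp n wt j (w j)).prod =
      algebraMap R (HYRing R) (wt (List.ofFn w)) := by
  have h := prodFrom_ofFn n wt n 0 w
  simp only [zero_add] at h
  rw [← h]
  refine Finsupp.lhom_ext fun s r => ?_
  rw [prodFrom_zero_single n wt (by simp [List.ofFn_eq_nil_iff, hn]) (by simp),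
    algebraMap_hyRing_apply]

end Machine

/-! ### The formula of size `O(dn)` for a given polynomial -/

section Formula

variable {R : Type u} [CommRing R] {n : ℕ}

open MvPolynomial

/-- The weight of a completed run: the coefficient of `f` at the exponent word read.
[cite: HrubesYehudayoff2011, Thm. 3.2 (proof: the relations `F_J = f_J`)] -/
def wtOf (f : MvPolynomial (Fin n) R) (L : List ℕ) : R :=
  MvPolynomial.coeff (Finsupp.equivFunOnFinite.symm fun j : Fin n => L.getD j 0) f

/-- **The formula** for `f` with degree bound `d` over `HYRing R`: the ordered product over the
variables `x_0, …, x_{n-1}` of the Horner blocks `∑_{e ≤ d} Z_{j,e} x_j^e` (the tree's variant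
of HY's `∏_i ∑_j z_{ij} x_j`). [cite: HrubesYehudayoff2011, Thm. 3.2 (proof, formula (3.1))] -/
def hyFormula (d : ℕ) (f : MvPolynomial (Fin n) R) : NCFormula (HYRing R) (Fin n) :=
  NCFormula.prodList (List.ofFn fun j : Fin n =>
    NCFormula.horner j d (fun e => zOp n (wtOf f) j e))

/-- Size count: `n` Horner blocks of `4d+1` nodes and `n-1` product nodes. [folklore] -/
theorem size_hyFormula_add_one (hn : n ≠ 0) (d : ℕ) (f : MvPolynomial (Fin n) R) :
    (hyFormula d f).size + 1 = n * (4 * d + 2) := by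
  obtain ⟨k, rfl⟩ := Nat.exists_eq_succ_of_ne_zero hn
  rw [hyFormula, List.ofFn_succ, NCFormula.size_prodList_cons]
  simp only [List.map_cons, List.sum_cons, List.length_cons, List.map_ofFn, List.length_ofFn,
    List.sum_ofFn, Function.comp_def, NCFormula.size_horner, Finset.sum_const, Finset.card_univ,
    Fintype.card_fin, smul_eq_mul, Nat.succ_eq_add_one]
  ring

/-- The exponent vector of a word. [folklore] -/
def expv (w : Fin n → ℕ) : Fin n →₀ ℕ := ∑ j, w j • Finsupp.single j 1

/-- Coordinates of the exponent vector. [folklore] -/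
@[simp]
theorem expv_apply (w : Fin n → ℕ) (i : Fin n) : expv w i = w i := by
  simp [expv, Finsupp.finsetSum_apply, Finsupp.single_apply]

/-- The weight of a tabulated word is the corresponding coefficient. [folklore] -/
theorem wtOf_ofFn (f : MvPolynomial (Fin n) R) (w : Fin n → ℕ) :
    wtOf f (List.ofFn w) = MvPolynomial.coeff (expv w) f := by
  unfold wtOf
  congr 1
  ext j
  simp [List.getD_eq_getElem?_getD]

/-- The formula computes `∑_w coeff_w(f) · x^w` over all exponent words `w ∈ {0,…,d}^n`.
[cite: HrubesYehudayoff2011, Thm. 3.2 (proof)] -/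
theorem eval_hyFormula (hn : n ≠ 0) (d : ℕ) (f : MvPolynomial (Fin n) R) :
    (hyFormula d f).eval = ∑ w : Fin n → Fin (d + 1),
      single (expv fun j => (w j : ℕ))
        (algebraMap R (HYRing R) (MvPolynomial.coeff (expv fun j => (w j : ℕ)) f)) := by
  rw [hyFormula, NCFormula.eval_prodList, List.map_ofFn]
  simp only [Function.comp_def, NCFormula.eval_horner]
  rw [prod_ofFn_sum_single]
  refine Finset.sum_congr rfl fun w _ => ?_
  rw [prod_zOp_eq_algebraMap n (wtOf f) hn (fun j => (w j : ℕ)), wtOf_ofFn]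
  rfl

/-- Exponents of monomials in the support are bounded by the total degree. [folklore] -/
theorem apply_le_totalDegree {σ : Type v} {f : MvPolynomial σ R} {m : σ →₀ ℕ}
    (hm : m ∈ f.support) (i : σ) : m i ≤ f.totalDegree := by
  refine le_trans ?_ (MvPolynomial.le_totalDegree hm)
  by_cases hi : i ∈ m.support
  · exact Finset.single_le_sum (f := fun j => m j) (fun _ _ => Nat.zero_le _) hi
  · rw [Finsupp.notMem_support_iff.mp hi]; exact Nat.zero_le _

/-- **The formula computes `f` over `R' = HYRing R`** (`f` of total degree `≤ d`, `n ≥ 1`).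
[cite: HrubesYehudayoff2011, Thm. 3.2] -/
theorem eval_hyFormula_eq (hn : n ≠ 0) {d : ℕ} {f : MvPolynomial (Fin n) R}
    (hd : f.totalDegree ≤ d) :
    (hyFormula d f).eval = baseChange (HYRing R) f := by
  rw [eval_hyFormula hn]
  refine AddMonoidAlgebra.ext (Finsupp.ext fun m => ?_)
  rw [coeff_baseChange, AddMonoidAlgebra.coeff_sum, Finsupp.finsetSum_apply]
  simp only [AddMonoidAlgebra.coeff_single, Finsupp.single_apply]
  by_cases hm : ∀ j, m j ≤ d
  · -- exactly one word has exponent vector `m`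
    let w₀ : Fin n → Fin (d + 1) := fun j => ⟨m j, Nat.lt_succ_of_le (hm j)⟩
    have hw₀ : (expv fun j => ((w₀ j : Fin (d + 1)) : ℕ)) = m := by
      ext j; simp [w₀]
    rw [Finset.sum_eq_single w₀]
    · simp [hw₀]
    · intro w _ hw
      rw [if_neg]
      intro h
      apply hw
      funext j
      apply Fin.ext
      have := congrArg (fun v => v j) h
      simpa [w₀] using this
    · intro h; exact absurd (Finset.mem_univ _) h
  · -- no word has exponent vector `m`, and `coeff m f = 0` by the degree bound
    push Not at hm
    obtain ⟨j, hj⟩ := hm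
    have hcoeff : MvPolynomial.coeff m f = 0 := by
      by_contra hne
      have hmem : m ∈ f.support := MvPolynomial.mem_support_iff.mpr hne
      have := apply_le_totalDegree hmem j
      omega
    rw [hcoeff, map_zero]
    refine Finset.sum_eq_zero fun w _ => ?_
    rw [if_neg]
    intro h
    have := congrArg (fun v => v j) h
    simp only [expv_apply] at this
    have h2 := (w j).2
    omega

/-- **The construction, packaged**: every `f` of total degree `≤ d` in `n` variables over a
commutative ring `R` has a formula of size `≤ 6dn + 1` over `HYRing R` (constants: HY print
`O(dn)`; here `4dn + 2n - 1` when `f` is nonconstant, and `1` for constants).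
[cite: HrubesYehudayoff2011, Thm. 3.2 and Cor. 3.3] -/
theorem exists_ncFormula_baseChange (d : ℕ) (f : MvPolynomial (Fin n) R)
    (hd : f.totalDegree ≤ d) :
    ∃ φ : NCFormula (HYRing R) (Fin n),
      φ.eval = baseChange (HYRing R) f ∧ φ.size ≤ 6 * (d * n) + 1 := by
  by_cases h0 : f.totalDegree = 0
  · refine ⟨NCFormula.const (algebraMap R (HYRing R) (MvPolynomial.coeff 0 f)), ?_, by simp⟩
    have hf : f = C (MvPolynomial.coeff 0 f) := MvPolynomial.totalDegree_eq_zero_iff_eq_C.mp h0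
    refine AddMonoidAlgebra.ext (Finsupp.ext fun m => ?_)
    rw [coeff_baseChange, NCFormula.eval_const, AddMonoidAlgebra.coeff_single,
      Finsupp.single_apply]
    conv_rhs => rw [hf, MvPolynomial.coeff_C]
    by_cases hm : (0 : Fin n →₀ ℕ) = m
    · rw [if_pos hm, if_pos hm]
    · rw [if_neg hm, if_neg hm, map_zero]
  · have hn : n ≠ 0 := by
      rintro rfl
      exact h0 (by rw [MvPolynomial.eq_C_of_isEmpty f, MvPolynomial.totalDegree_C])
    have hd1 : 1 ≤ d := by omega
    refine ⟨hyFormula d f, eval_hyFormula_eq hn hd, ?_⟩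
    have hs := size_hyFormula_add_one hn d f
    have h1 : n ≤ d * n := Nat.le_mul_of_pos_left n hd1
    have h2 : n * (4 * d + 2) = 4 * (d * n) + 2 * n := by ring
    omega

/-- **Hrubeš–Yehudayoff Thm. 3.2 / Cor. 3.3, explicit form (proved):** `L_{R'}(f) ≤ 6dn + 1`
over the single extension ring `R' = HYRing R ⊇ R` (with `R` central), for every `f ∈ R[X]` of
total degree `≤ d` in `n` variables. [cite: HrubesYehudayoff2011, Thm. 3.2 and Cor. 3.3] -/
theorem ncFormulaSize_baseChange_le (d : ℕ) (f : MvPolynomial (Fin n) R)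
    (hd : f.totalDegree ≤ d) :
    ncFormulaSize (baseChange (HYRing R) f) ≤ 6 * (d * n) + 1 := by
  obtain ⟨φ, hφ, hs⟩ := exists_ncFormula_baseChange d f hd
  exact (ncFormulaSize_le_size φ hφ).trans hs

end Formula

/-! ### The printed statements as named facts (D-0014) -/

/-- **Hrubeš–Yehudayoff 2011, Thm. 3.2** (commutative base ring; `O(dn)` rendered as
`c · (dn + 1)`): there is a constant `c` such that for every commutative ring `R`, every `n, d`
and every `f ∈ R[x_1,…,x_n]` of degree `≤ d` there is a ring `R' ⊇ R` with `R` in its centre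
(an `R`-algebra with injective structure map) and `L_{R'}(f) ≤ c (dn + 1)`. Print: "Let `R` be a
ring [not necessarily commutative]. Let `f ∈ R[X]` be a polynomial of degree `d` ... Then there
exists `R' ⊇ R` such that `L_{R'}(f) = O(dn)`." [cite: HrubesYehudayoff2011, Thm. 3.2] -/
def HrubesYehudayoff2011_thm32 : Prop :=
  ∃ c : ℕ, ∀ (R : Type u) [CommRing R] (n d : ℕ) (f : MvPolynomial (Fin n) R),
    f.totalDegree ≤ d →
      ∃ (R' : Type u) (_ : Ring R') (_ : Algebra R R'),
        Function.Injective (algebraMap R R') ∧ ncFormulaSize (baseChange R' f) ≤ c * (d * n + 1)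

/-- **Hrubeš–Yehudayoff 2011, Cor. 3.3** (commutative base ring): for every commutative ring `R`
there is ONE ring `R' ⊇ R` (`R` central) such that `L_{R'}(f) ≤ c (dn + 1)` for every `f` of
degree `≤ d` in `n` variables, all `n, d`. Print: "Then there exists a ring `R' ⊇ R` such that
for every `f ∈ R[X]` of degree `d`, `L_{R'}(f) = O(dn)`. The ring `R'` depends neither on `f` nor
on `d`, and it has infinite dimension over `R`." [cite: HrubesYehudayoff2011, Cor. 3.3] -/
def HrubesYehudayoff2011_cor33 : Prop :=
  ∃ c : ℕ, ∀ (R : Type u) [CommRing R],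
    ∃ (R' : Type u) (_ : Ring R') (_ : Algebra R R'), Function.Injective (algebraMap R R') ∧
      ∀ (n d : ℕ) (f : MvPolynomial (Fin n) R), f.totalDegree ≤ d →
        ncFormulaSize (baseChange R' f) ≤ c * (d * n + 1)

/-- **Hrubeš–Yehudayoff 2011, Thm. 3.4 (formula half): commutative extensions do not help over
an algebraically closed field.** "Assume that `F` is an algebraically closed field. Let `R` be a
subring of `F` and let `R' ⊇ R` be a commutative ring. Then for every `f ∈ R[X]`, we have
`C_F(f) ≤ C_{R'}(f)` and `L_F(f) ≤ L_{R'}(f)`." (Proof: replace the constants of `R' ∖ R` by new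
variables and specialise them in `F` by the weak Nullstellensatz.) Rendered for formulas in the
model `NCFormula` ("subring" = injective ring map `R → F`; "`R' ⊇ R` commutative" = commutative
`R`-algebra with injective structure map). Named fact, not proved in this file (discharged as
`HrubesYehudayoff2011_thm34_formulas_holds` in `NoncommutativeExtensionsProofs.lean`); the circuit
half is not transcribed (the tree's `NCFormula` model has formulas only).
[cite: HrubesYehudayoff2011, Thm. 3.4] -/
def HrubesYehudayoff2011_thm34_formulas : Prop :=
  ∀ (R F : Type u) [CommRing R] [Field F] [IsAlgClosed F] [Algebra R F],
    Function.Injective (algebraMap R F) →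
    ∀ (R' : Type u) [CommRing R'] [Algebra R R'], Function.Injective (algebraMap R R') →
      ∀ (n : ℕ) (f : MvPolynomial (Fin n) R),
        ncFormulaSize (baseChange F f) ≤ ncFormulaSize (baseChange R' f)

/-- **Hrubeš–Yehudayoff 2011, Thm. 4.2 (formula half): extensions of small dimension do not
help much.** "Let `R` and `R' ⊇ R` be rings such that `dim_R(R') = k`. Let `f ∈ R[X]`. Then
`C_R(f) ≤ O(k³) C_{R'}(f)` and `L_R(f) ≤ (L_{R'}(f))^{O(log k)}`", where `dim_R(R') = k` asks for
`e_1 = 1, e_2, …, e_k ∈ R'` commuting with `R` such that every element of `R'` is uniquely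
`∑ b_i e_i`, `b_i ∈ R` (§2). Rendered for a commutative base ring `R` (then: an `R`-basis
`e : Fin k → R'` of the `R`-algebra `R'` with `e 0 = 1`) and with `O(log k)` as
`c · (⌊log₂ k⌋ + 1)`. Named fact, not proved here. [cite: HrubesYehudayoff2011, Thm. 4.2 (with §2, dim_R)] -/
def HrubesYehudayoff2011_thm42_formulas : Prop :=
  ∃ c : ℕ, ∀ (R : Type u) [CommRing R] (R' : Type u) [Ring R'] [Algebra R R'] (k : ℕ)
    (e : Module.Basis (Fin k) R R'), (∃ i, e i = 1) →
      ∀ (n : ℕ) (f : MvPolynomial (Fin n) R),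
        ncFormulaSize (baseChange R f) ≤ (ncFormulaSize (baseChange R' f)) ^ (c * (Nat.log 2 k + 1))

/-! ### Technique class and the barrier -/

/-- **Technique class: extension-robust formula lower bounds.** The statement
"`L_{R'}(f) ≥ s` for EVERY ring `R' ⊇ R` having `R` in its centre" (every `R`-algebra `R'` with
injective structure map, ring operations of `R'` at unit cost) — what an argument insensitive to
the coefficient ring establishes when it establishes `L_R(f) ≥ s`. (The universe of `R'` is that
of `R`.) [cite: HrubesYehudayoff2011, §1 ("is it easier to compute `f` over a ring extension `R ⊇ F` than over `F`?") and Thm. 3.2] -/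
def ExtensionRobustLowerBound (R : Type u) [CommRing R] {n : ℕ} (f : MvPolynomial (Fin n) R)
    (s : ℕ) : Prop :=
  ∀ (R' : Type u) [Ring R'] [Algebra R R'], Function.Injective (algebraMap R R') →
    s ≤ ncFormulaSize (baseChange R' f)

/-- The class is monotone: a robust bound implies every smaller robust bound. [folklore] -/
theorem ExtensionRobustLowerBound.mono {R : Type u} [CommRing R] {n : ℕ}
    {f : MvPolynomial (Fin n) R} {s s' : ℕ} (hs : s' ≤ s) (h : ExtensionRobustLowerBound R f s) :
    ExtensionRobustLowerBound R f s' :=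
  fun R' _ _ hι => hs.trans (h R' hι)

/-- Non-vacuity: the trivial bound `L ≥ 1` is extension-robust for every `f`. [folklore] -/
theorem extensionRobustLowerBound_one {R : Type u} [CommRing R] {n : ℕ}
    (f : MvPolynomial (Fin n) R) : ExtensionRobustLowerBound R f 1 :=
  fun _ _ _ _ => one_le_ncFormulaSize _

/-- **Barrier: extension-robust lower bounds cannot exceed `6dn + 1`** (Hrubeš–Yehudayoff 2011,
Thm. 3.2 / Cor. 3.3, in the tree's explicit form).

BARRIER
technique_class: ring-independent, extension-robust, coefficient-ring-oblivious, unit-cost-ring-operations, formula-size lower bounds valid over every noncommutative extension ring with the base field central (`ExtensionRobustLowerBound R f s`)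
blocks: superlinear-in-`dn` — in particular super-polynomial — FORMULA lower bounds (hence also circuit lower bounds, a formula being a circuit) for ANY explicit `f` of degree `≤ d` in `n` variables, e.g. `per_n`, `det_n` (`d = n`, `n²` variables: nothing beyond `6n³ + 1`), i.e. this way to `VNP ⊄ VF` / `VNP ⊄ VP` (consequences of `ValiantsHypothesis`), by any argument in the class: `NoncommutativeExtensions` = no `ExtensionRobustLowerBound R f s` with `s > 6dn + 1` (proved: pointed form `not_extensionRobustLowerBound` below, canonical discharge `NoncommutativeExtensions_holds` in `NoncommutativeExtensionsProofs.lean`), because `L_{R'}(f) ≤ 6dn + 1` over `R' = HYRing R` (`ncFormulaSize_baseChange_le`) — "if one allows noncommutative ring extensions of arbitrary dimension, every polynomial can be computed by a polynomial-size formula", `L_{R'}(f) = O(dn)` [cite: HrubesYehudayoff2011, Thm. 3.2 and Cor. 3.3].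
because: over the free algebra `S = R⟨z_{ij}⟩` the size-`O(dn)` formula `∏_{i ≤ d} ∑_j z_{ij} x_j` has coefficients `F_J ∈ S`, and the two-sided ideal `I` generated by the `F_J - f_J` meets `R` only in `0`, so `R ⊆ R' = S/I` and the formula computes `f` over `R'` ("noncommutativity and a significant increase in dimension are inevitable"; dimension "roughly `n^d`"; a direct-sum/union construction makes `R'` independent of `f` and `d`) [cite: HrubesYehudayoff2011, Thm. 3.2 (proof) and Cor. 3.3 (proof)]; the tree realises the same relations by operators on the free `R`-module on stacks of frames: the ordered product of the letters of an exponent word is the scalar `coeff_w(f)` (`prod_zOp_eq_algebraMap`), so the product of `n` Horner blocks of size `4d+1` evaluates to `f` (`eval_hyFormula_eq`).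
evasions_known: arguments may use commutativity or finite-dimensionality of the coefficient ring — over an algebraically closed `F` no COMMUTATIVE extension lowers `C` or `L` (`HrubesYehudayoff2011_thm34_formulas`) [cite: HrubesYehudayoff2011, Thm. 3.4], hard zero-one polynomials exist over every field and hence over every commutative ring [cite: HrubesYehudayoff2011, Thm. 3.7 and Cor. 3.8], and an extension of dimension `k` saves at most a factor `O(k³)` for circuits and an exponent `O(log k)` for formulas (`HrubesYehudayoff2011_thm42_formulas`) [cite: HrubesYehudayoff2011, Thm. 4.2]; field-size-sensitive phenomena are real (elementary symmetric polynomials via interpolation over large fields; exponential depth-three lower bounds known only over finite fields) [cite: HrubesYehudayoff2011, §1].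
scope_caveats: Hrubeš–Yehudayoff state Thm. 3.2 as an upper bound ("a mildly surprising observation (that generalizes the Clifford-based formulas for the permanent)"), not as a barrier, and do not inventory which known lower-bound techniques are extension-robust — the technique-class reading is the contrapositive and is this entry's [cite: HrubesYehudayoff2011, §1]; unit-cost model ("addition and multiplication of elements of the underlying ring can be performed at unit cost, no matter how complicated the ring is") [cite: HrubesYehudayoff2011, §1]; print allows a noncommutative BASE ring `R` in Thm. 3.2 / Cor. 3.3, the tree proves the commutative-base case (which contains the case `R = F` a field) with `R' = HYRing R` infinite-dimensional (as in Cor. 3.3; the `R'` of Thm. 3.2 has finite dimension ≈ `n^d`) [cite: HrubesYehudayoff2011, Thm. 3.2 and Cor. 3.3]; constants: print `O(dn)` for degree `d`, tree `6dn + 1` for total degree `≤ d`; formulas only (`C ≤ L`), Thm. 3.4 / 4.2 vendored as facts without proof and without their circuit halves.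
status: theorem (established; Thm. 3.2 / Cor. 3.3 proved here as `ncFormulaSize_baseChange_le`, the barrier here as `not_extensionRobustLowerBound` and, in the fact's own quantified form, as `NoncommutativeExtensions_holds` in `NoncommutativeExtensionsProofs.lean`) [cite: HrubesYehudayoff2011, Thm. 3.2 and Cor. 3.3] -/
def NoncommutativeExtensions : Prop :=
  ∀ (R : Type u) [CommRing R] (n d : ℕ) (f : MvPolynomial (Fin n) R), f.totalDegree ≤ d →
    ∀ s : ℕ, 6 * (d * n) + 1 < s → ¬ ExtensionRobustLowerBound R f s

/-- **The barrier holds** (pointed form): for `f` of total degree `≤ d` in `n` variables, no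
extension-robust formula lower bound exceeds `6dn + 1` — a robust bound `s` would hold over
`R' = HYRing R ⊇ R` (`algebraMap_hyRing_injective`), where `L_{R'}(f) ≤ 6dn + 1`
(`ncFormulaSize_baseChange_le`). The fact's own quantified form `NoncommutativeExtensions` is
discharged from this as `NoncommutativeExtensions_holds` (`NoncommutativeExtensionsProofs.lean`).
[cite: HrubesYehudayoff2011, Thm. 3.2] -/
theorem not_extensionRobustLowerBound {R : Type u} [CommRing R] {n d : ℕ}
    {f : MvPolynomial (Fin n) R} (hd : f.totalDegree ≤ d) {s : ℕ} (hs : 6 * (d * n) + 1 < s) :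
    ¬ ExtensionRobustLowerBound R f s := by
  intro h
  have h1 := h (HYRing R) (algebraMap_hyRing_injective R)
  have h2 := ncFormulaSize_baseChange_le d f hd
  omega

/-- The largest extension-robust bound is at most `6dn + 1`: if `L_{R'}(f) ≥ s` robustly then
`s ≤ 6dn + 1`. [cite: HrubesYehudayoff2011, Thm. 3.2] -/
theorem ExtensionRobustLowerBound.le {R : Type u} [CommRing R] {n d : ℕ}
    {f : MvPolynomial (Fin n) R} (hd : f.totalDegree ≤ d) {s : ℕ}
    (h : ExtensionRobustLowerBound R f s) : s ≤ 6 * (d * n) + 1 := by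
  by_contra hlt
  exact not_extensionRobustLowerBound hd (not_le.mp hlt) h

end Literature.Barriers.ValiantsHypothesis
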